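import Literature.Analysis.FluidPDE.TorusWeightedVorticityBalance
import HarnessLib

/-!
# Gibbon's vorticity-moment balance `J̇ₘ`, `Jₘ = ∫_{T^d} |ω|^{2m}` (Gibbon 2010, App. A)

Analysis/FluidPDE proof file (theorems only). Corollaries of the weighted balance
`d/dt ∫ Φ(|ω|²)` (`TorusWeightedVorticityBalance`) along classical Navier–Stokes solutions on the
flat torus:

* `IsClassicalNSSolutionOn.deriv_integral_comp_torusVorticitySqAt_le` — for `ν ≥ 0` and a weight
  with `Φ' ≥ 0`, `Φ'' ≥ 0` at the values of `|ω|²`, every one-sided derivative `R` of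
  `∫ Φ(|ω|²)` obeys `R ≤ 2∫Φ'(|ω|²)σ + ∫Φ'(|ω|²)∑ᵢⱼWᵢⱼ(∂ᵢfⱼ − ∂ⱼfᵢ)` (the viscous term is
  nonpositive — "the negativity of the right hand side … is important", Gibbon 2010, App. A step 1);
* `IsClassicalNSSolutionOn.hasDerivWithinAt_integral_torusVorticitySqAt_pow` — power weights,
  `d/dt ∫|ω|^{2m} = 2m∫|ω|^{2(m−1)}σ − ν(m∫|ω|^{2(m−1)}∑(∂W)² + m(m−1)∫|ω|^{2(m−2)}∑(∂|ω|²)²) + m∫|ω|^{2(m−1)}∑W·curl f`,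
  which for `d = 3` is Gibbon 2010, App. A (proof of Prop. 1), opening identity
  `(1/2m) J̇ₘ = ∫|ω|^{2(m−1)} ω·(νΔω + (ω·∇)u + curl f)` with the Laplacian term evaluated exactly
  (App. A step 1: `∫|ω|^{2(m−1)}ω·Δω ≤ −(2(m−1)/m²)∫|∇(|ω|ᵐ)|²`);
* `IsClassicalNSSolutionOn.deriv_integral_torusVorticitySqAt_pow_le` — UNFORCED, `ν ≥ 0`, `m ≥ 1`:
  `R ≤ 2m ∫ |ω|^{2(m−1)} σ` for every one-sided derivative `R` of `∫|ω|^{2m}` (at `m = 1`, `d = 3`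
  the enstrophy inequality `dℰ/dt ≤ ∫ω·Sω`, Doering–Gibbon 1995 (6.5.18)); this is the dynamic
  reduction that turns a static bound on `∫|ω|^{2(m−1)}σ` into a rate bound for `∫|ω|^{2m}`;
* `sum_torusVorticityTensor_mul_curl_zero_force` — the forcing term vanishes for `f = 0`.

## References

* A. J. Majda, A. L. Bertozzi, *Vorticity and Incompressible Flow*, CUP 2002, §1.4 (1.18)–(1.21)
  (`𝒟`, `Ω`, `ω`, `Ωh = ½ω × h`), proof of Prop. 1.5: (1.29) `DV/Dt + V² = −P + νΔV`, (1.31)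
  `DΩ/Dt + Ω𝒟 + 𝒟Ω = νΔΩ`, (1.32) `Dω/Dt = 𝒟ω + νΔω` (held: book:majda2002-vorticity-incompressible-flow,
  chunks 15, 18–19). [MajdaBertozziCUP2002]
* J. D. Gibbon, *Regularity and singularity in solutions of the three-dimensional Navier–Stokes
  equations*, Proc. R. Soc. A 466 (2010) 2587–2604, doi:10.1098/rspa.2009.0642; §2 (definition
  `Jₘ = ∫|ω|^{2m} dV` on the periodic box `[0, L]³`) and Appendix A (proof of Prop. 1): the first
  display is `(1/2m) J̇ₘ = ∫ |ω|^{2(m−1)} ω·{νΔω + ω·∇u + curl f} dV`, step 1 bounds the Laplacian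
  term by `−(2(m−1)/m²)∫|∇(|ω|ᵐ)|²` (held: paper:arxiv-0905.0344, chunks 5–6, 9). [Gibbon2010]
* C. R. Doering, J. D. Gibbon, *Applied Analysis of the Navier–Stokes Equations*, CUP 1995, §6.5
  (6.5.18). [DoeringGibbon1995]
-/

noncomputable section

open Set MeasureTheory Finset
open scoped ContDiff InnerProductSpace RealInnerProductSpace

namespace Literature.Analysis.FluidPDE

open Literature.Analysis.FunctionSpaces

variable {d : Type*} [Fintype d] [DecidableEq d]

/-! ### Corollaries: sign form, power weights (Gibbon's `Jₘ`), the unforced case -/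

/-- **One-sided bound with a convex nondecreasing weight** (Gibbon 2010, App. A, step 1: the
Laplacian term of the `Jₘ` balance is nonpositive — "The negativity of the right hand side of
[the Laplacian estimate] is important" — so it may be dropped for upper bounds). In the setting of
`hasDerivWithinAt_integral_comp_torusVorticitySqAt`, if `ν ≥ 0` and `Φ' ≥ 0`, `Φ'' ≥ 0` at the
values of `|ω(t)|²`, every one-sided derivative value `R` of `s ↦ ∫ Φ(|ω(s)|²)` within `[a, b]` at
`t` satisfies `R ≤ 2∫ Φ'(|ω|²) σ + ∫ Φ'(|ω|²) ∑ᵢⱼ Wᵢⱼ(∂ᵢfⱼ − ∂ⱼfᵢ)`. [cite: Gibbon2010, Appendix A (proof of Prop. 1), step 1] -/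
theorem _root_.Literature.Analysis.FunctionSpaces.Torus.IsClassicalNSSolutionOn.deriv_integral_comp_torusVorticitySqAt_le
    {a b ν : ℝ} {f u : ℝ → UnitAddTorus d → EuclideanSpace ℝ d} {p : ℝ → UnitAddTorus d → ℝ}
    (h : Torus.IsClassicalNSSolutionOn (Icc a b) ν f u p) (hν : 0 ≤ ν) (hab : a < b) {Φ : ℝ → ℝ}
    {U : Set ℝ} (hUo : IsOpen U) (hΦ : ContDiffOn ℝ ∞ Φ U)
    (hmaps : ∀ s ∈ Icc a b, ∀ x, torusVorticitySqAt (u s) x ∈ U) {t : ℝ} (ht : t ∈ Icc a b)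
    (hΦ1 : ∀ x, 0 ≤ deriv Φ (torusVorticitySqAt (u t) x))
    (hΦ2 : ∀ x, 0 ≤ deriv (deriv Φ) (torusVorticitySqAt (u t) x)) {R : ℝ}
    (hR : HasDerivWithinAt (fun s => ∫ x, Φ (torusVorticitySqAt (u s) x)) R (Icc a b) t) :
    R ≤ 2 * (∫ x, deriv Φ (torusVorticitySqAt (u t) x) * torusStretchingDensity (u t) x) +
      ∫ x, deriv Φ (torusVorticitySqAt (u t) x) * ∑ i, ∑ j, torusVorticityTensor (u t) i j x *
        (Torus.partialDeriv i (f t) x j - Torus.partialDeriv j (f t) x i) := by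
  have hD := h.hasDerivWithinAt_integral_comp_torusVorticitySqAt hab hUo hΦ hmaps ht
  have hU : UniqueDiffWithinAt ℝ (Icc a b) t := uniqueDiffOn_Icc hab t ht
  have hReq := (hR.derivWithin hU).symm.trans (hD.derivWithin hU)
  have h1 : 0 ≤ ∫ x, deriv Φ (torusVorticitySqAt (u t) x) * ∑ k, ∑ i, ∑ j,
      Torus.partialDeriv k (torusVorticityTensor (u t) i j) x ^ 2 :=
    integral_nonneg fun x => mul_nonneg (hΦ1 x) (Finset.sum_nonneg fun k _ =>
      Finset.sum_nonneg fun i _ => Finset.sum_nonneg fun j _ => sq_nonneg _)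
  have h2 : 0 ≤ ∫ x, deriv (deriv Φ) (torusVorticitySqAt (u t) x) *
      ∑ k, Torus.partialDeriv k (torusVorticitySqAt (u t)) x ^ 2 :=
    integral_nonneg fun x => mul_nonneg (hΦ2 x) (Finset.sum_nonneg fun k _ => sq_nonneg _)
  rw [hReq]
  nlinarith [mul_nonneg hν (add_nonneg h1 h2)]

/-- In the UNFORCED case the forcing term of the weighted balance vanishes. [folklore] -/
private theorem sum_torusVorticityTensor_mul_curl_zero_force (v : UnitAddTorus d → EuclideanSpace ℝ d)
    (t : ℝ) (x : UnitAddTorus d) :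
    ∑ i, ∑ j, torusVorticityTensor v i j x *
      (Torus.partialDeriv i ((0 : ℝ → UnitAddTorus d → EuclideanSpace ℝ d) t) x j -
        Torus.partialDeriv j ((0 : ℝ → UnitAddTorus d → EuclideanSpace ℝ d) t) x i) = 0 := by
  have h0 : ∀ i, Torus.partialDeriv i (0 : UnitAddTorus d → EuclideanSpace ℝ d) x = 0 := by
    intro i
    simp [Torus.partialDeriv, Torus.lineDeriv]
  simp [h0]

/-- **Gibbon's moment balance `J̇ₘ` (power weights)** (Gibbon 2010, §2: `Jₘ(t) = ∫ |ω|^{2m} dV`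
on the periodic box; App. A, proof of Prop. 1, opening identity
`(1/2m) J̇ₘ = ∫ |ω|^{2(m−1)} ω·{νΔω + ω·∇u + curl f} dV`). Along a classical solution on
`T^d × [a, b]` (`a < b`), for every `m : ℕ` and `t ∈ [a, b]`,
`s ↦ ∫ (torusVorticitySqAt (u s) x)^m = ∫ |ω(s)|^{2m}` has the one-sided derivative

`2m ∫ |ω|^{2(m−1)} σ − ν (m ∫ |ω|^{2(m−1)} ∑ₖ∑ᵢⱼ(∂ₖWᵢⱼ)² + m(m−1) ∫ |ω|^{2(m−2)} ∑ₖ(∂ₖ|ω|²)²) + m ∫ |ω|^{2(m−1)} ∑ᵢⱼ Wᵢⱼ(∂ᵢfⱼ − ∂ⱼfᵢ)`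

within `[a, b]` (natural-number exponents: `|ω|^{2(m−1)}` reads `1` for `m = 0, 1`, and the
`m(m−1)` term vanishes for `m ≤ 1`). For `d = 3` (`σ = ω·𝒟ω = ω·(ω·∇u)`,
`∑ᵢⱼ WᵢⱼΔWᵢⱼ = 2ω·Δω`, `∑ₖ∑ᵢⱼ(∂ₖWᵢⱼ)² = 2|∇ω|²`, `∑ᵢⱼWᵢⱼ(∂ᵢfⱼ − ∂ⱼfᵢ) = 2ω·curl f`) this is
`2m ×` the printed identity, with the Laplacian term evaluated exactly by parts (App. A step 1
bounds it: `∫|ω|^{2(m−1)}ω·Δω ≤ −(2(m−1)/m²)∫|∇(|ω|ᵐ)|²`). [cite: Gibbon2010, Appendix A (proof of Prop. 1), opening identity] -/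
theorem _root_.Literature.Analysis.FunctionSpaces.Torus.IsClassicalNSSolutionOn.hasDerivWithinAt_integral_torusVorticitySqAt_pow
    {a b ν : ℝ} {f u : ℝ → UnitAddTorus d → EuclideanSpace ℝ d} {p : ℝ → UnitAddTorus d → ℝ}
    (h : Torus.IsClassicalNSSolutionOn (Icc a b) ν f u p) (hab : a < b) (m : ℕ) {t : ℝ}
    (ht : t ∈ Icc a b) :
    HasDerivWithinAt (fun s => ∫ x, torusVorticitySqAt (u s) x ^ m)
      (2 * m * (∫ x, torusVorticitySqAt (u t) x ^ (m - 1) * torusStretchingDensity (u t) x) -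
        ν * (m * (∫ x, torusVorticitySqAt (u t) x ^ (m - 1) * ∑ k, ∑ i, ∑ j,
              Torus.partialDeriv k (torusVorticityTensor (u t) i j) x ^ 2) +
            m * (m - 1) * ∫ x, torusVorticitySqAt (u t) x ^ (m - 2) *
              ∑ k, Torus.partialDeriv k (torusVorticitySqAt (u t)) x ^ 2) +
        m * ∫ x, torusVorticitySqAt (u t) x ^ (m - 1) * ∑ i, ∑ j, torusVorticityTensor (u t) i j x *
          (Torus.partialDeriv i (f t) x j - Torus.partialDeriv j (f t) x i))
      (Icc a b) t := by
  have hΦ : ContDiffOn ℝ ∞ (fun s : ℝ => s ^ m) univ := (contDiff_id.pow m).contDiffOn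
  have hD := h.hasDerivWithinAt_integral_comp_torusVorticitySqAt hab isOpen_univ hΦ
    (fun _ _ _ => mem_univ _) ht
  have hd1 : ∀ y : ℝ, deriv (fun s : ℝ => s ^ m) y = m * y ^ (m - 1) := fun y => by
    simp
  have hd1' : deriv (fun s : ℝ => s ^ m) = fun y => (m : ℝ) * y ^ (m - 1) := funext hd1
  have hd2 : ∀ y : ℝ, deriv (deriv (fun s : ℝ => s ^ m)) y = m * (m - 1) * y ^ (m - 2) := by
    intro y
    rw [hd1', deriv_const_mul _ (differentiableAt_pow _)]
    have : deriv (fun y : ℝ => y ^ (m - 1)) y = ((m - 1 : ℕ) : ℝ) * y ^ (m - 1 - 1) := by simp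
    rw [this]
    rcases Nat.eq_zero_or_pos m with hm | hm
    · subst hm; simp
    · rw [Nat.cast_sub hm, show m - 1 - 1 = m - 2 by omega]
      push_cast
      ring
  simp only [hd1, hd2] at hD
  refine hD.congr_deriv ?_
  have e1 : ∫ x, (m : ℝ) * torusVorticitySqAt (u t) x ^ (m - 1) * torusStretchingDensity (u t) x =
      m * ∫ x, torusVorticitySqAt (u t) x ^ (m - 1) * torusStretchingDensity (u t) x := by
    rw [← integral_const_mul]
    exact integral_congr_ae (ae_of_all _ fun x => by ring)
  have e2 : ∫ x, (m : ℝ) * torusVorticitySqAt (u t) x ^ (m - 1) * ∑ k, ∑ i, ∑ j,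
      Torus.partialDeriv k (torusVorticityTensor (u t) i j) x ^ 2 =
      m * ∫ x, torusVorticitySqAt (u t) x ^ (m - 1) * ∑ k, ∑ i, ∑ j,
        Torus.partialDeriv k (torusVorticityTensor (u t) i j) x ^ 2 := by
    rw [← integral_const_mul]
    exact integral_congr_ae (ae_of_all _ fun x => by ring)
  have e3 : ∫ x, (m : ℝ) * (m - 1) * torusVorticitySqAt (u t) x ^ (m - 2) *
      ∑ k, Torus.partialDeriv k (torusVorticitySqAt (u t)) x ^ 2 =
      m * (m - 1) * ∫ x, torusVorticitySqAt (u t) x ^ (m - 2) *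
        ∑ k, Torus.partialDeriv k (torusVorticitySqAt (u t)) x ^ 2 := by
    rw [← integral_const_mul]
    exact integral_congr_ae (ae_of_all _ fun x => by ring)
  have e4 : ∫ x, (m : ℝ) * torusVorticitySqAt (u t) x ^ (m - 1) * ∑ i, ∑ j,
      torusVorticityTensor (u t) i j x *
        (Torus.partialDeriv i (f t) x j - Torus.partialDeriv j (f t) x i) =
      m * ∫ x, torusVorticitySqAt (u t) x ^ (m - 1) * ∑ i, ∑ j, torusVorticityTensor (u t) i j x *
        (Torus.partialDeriv i (f t) x j - Torus.partialDeriv j (f t) x i) := by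
    rw [← integral_const_mul]
    exact integral_congr_ae (ae_of_all _ fun x => by ring)
  rw [e1, e2, e3, e4]
  ring


/-- **Unforced moment inequality** (Gibbon 2010, App. A with `f = 0` and the nonpositive
Laplacian term of step 1 dropped: `(1/2m) J̇ₘ ≤ ∫ |ω|^{2(m−1)} ω·(ω·∇u)`). Along a classical
solution of the UNFORCED system (`f = 0`, `ν ≥ 0`, so Euler included) on `T^d × [a, b]`, for every
`m ≥ 1` and `t ∈ [a, b]`, every one-sided derivative value `R` of `s ↦ ∫ |ω(s)|^{2m}` within
`[a, b]` satisfies `R ≤ 2m ∫ |ω(t)|^{2(m−1)} σ(t)` (`m = 1`, `d = 3`: `dℰ/dt ≤ ∫ ω·𝒟ω`,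
Doering–Gibbon 1995 (6.5.18)). This is the dynamic reduction that turns a static bound on
`∫|ω|^{2(m−1)}σ` over divergence-free fields into a rate bound for `∫|ω|^{2m}`. [cite: Gibbon2010, Appendix A (proof of Prop. 1), opening identity and step 1] -/
theorem _root_.Literature.Analysis.FunctionSpaces.Torus.IsClassicalNSSolutionOn.deriv_integral_torusVorticitySqAt_pow_le
    {a b ν : ℝ} {u : ℝ → UnitAddTorus d → EuclideanSpace ℝ d} {p : ℝ → UnitAddTorus d → ℝ}
    (h : Torus.IsClassicalNSSolutionOn (Icc a b) ν 0 u p) (hν : 0 ≤ ν) (hab : a < b) {m : ℕ}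
    (hm : 1 ≤ m) {t : ℝ} (ht : t ∈ Icc a b) {R : ℝ}
    (hR : HasDerivWithinAt (fun s => ∫ x, torusVorticitySqAt (u s) x ^ m) R (Icc a b) t) :
    R ≤ 2 * m * ∫ x, torusVorticitySqAt (u t) x ^ (m - 1) * torusStretchingDensity (u t) x := by
  have hΦ : ContDiffOn ℝ ∞ (fun s : ℝ => s ^ m) univ := (contDiff_id.pow m).contDiffOn
  have hd1 : ∀ y : ℝ, deriv (fun s : ℝ => s ^ m) y = m * y ^ (m - 1) := fun y => by simp
  have hd1' : deriv (fun s : ℝ => s ^ m) = fun y => (m : ℝ) * y ^ (m - 1) := funext hd1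
  have hd2 : ∀ y : ℝ, deriv (deriv (fun s : ℝ => s ^ m)) y = m * (m - 1) * y ^ (m - 2) := by
    intro y
    rw [hd1', deriv_const_mul _ (differentiableAt_pow _)]
    have : deriv (fun y : ℝ => y ^ (m - 1)) y = ((m - 1 : ℕ) : ℝ) * y ^ (m - 1 - 1) := by simp
    rw [this, Nat.cast_sub hm, show m - 1 - 1 = m - 2 by omega]
    push_cast
    ring
  have hle := h.deriv_integral_comp_torusVorticitySqAt_le hν hab isOpen_univ hΦ
    (fun _ _ _ => mem_univ _) ht (fun x => ?_) (fun x => ?_) hR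
  · simp only [hd1, sum_torusVorticityTensor_mul_curl_zero_force, mul_zero, integral_zero,
      add_zero] at hle
    have e1 : ∫ x, (m : ℝ) * torusVorticitySqAt (u t) x ^ (m - 1) * torusStretchingDensity (u t) x =
        m * ∫ x, torusVorticitySqAt (u t) x ^ (m - 1) * torusStretchingDensity (u t) x := by
      rw [← integral_const_mul]
      exact integral_congr_ae (ae_of_all _ fun x => by ring)
    rw [e1, ← mul_assoc] at hle
    exact hle
  · rw [hd1]
    exact mul_nonneg (Nat.cast_nonneg m) (pow_nonneg (torusVorticitySqAt_nonneg _ _) _)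
  · rw [hd2]
    have hm1 : (0 : ℝ) ≤ (m : ℝ) - 1 := by
      have : (1 : ℝ) ≤ m := by exact_mod_cast hm
      linarith
    exact mul_nonneg (mul_nonneg (Nat.cast_nonneg m) hm1)
      (pow_nonneg (torusVorticitySqAt_nonneg _ _) _)

/-- **`Z_q`-shaped form at even `q = 2m`** (real powers, matching `Z_q = ∫ (|ω|²)^{q/2}`): along
a classical solution of the UNFORCED system (`ν ≥ 0`) on `T^d × [a, b]`, for `q = 2m`, `m ≥ 1`,
every one-sided derivative value `R` of `s ↦ ∫ (torusVorticitySqAt (u s) x)^{q/2}` within `[a, b]`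
at `t` satisfies `R ≤ q ∫ (|ω(t)|²)^{q/2 − 1} σ(t)` — Gibbon 2010, App. A with `f = 0` and the
nonpositive Laplacian term of step 1 dropped, `J̇ₘ ≤ 2m ∫|ω|^{2(m−1)} ω·(ω·∇u)`, `Jₘ = ∫|ω|^{2m}`;
`deriv_integral_torusVorticitySqAt_pow_le` rewritten through `s^{(2m)/2} = s^m`
(`Real.rpow_natCast`). [cite: Gibbon2010, Appendix A (proof of Prop. 1), opening identity and step 1] -/
theorem _root_.Literature.Analysis.FunctionSpaces.Torus.IsClassicalNSSolutionOn.deriv_integral_torusVorticitySqAt_rpow_le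
    {a b ν : ℝ} {u : ℝ → UnitAddTorus d → EuclideanSpace ℝ d} {p : ℝ → UnitAddTorus d → ℝ}
    (h : Torus.IsClassicalNSSolutionOn (Icc a b) ν 0 u p) (hν : 0 ≤ ν) (hab : a < b) {m : ℕ}
    (hm : 1 ≤ m) {q : ℝ} (hq : q = 2 * m) {t : ℝ} (ht : t ∈ Icc a b) {R : ℝ}
    (hR : HasDerivWithinAt (fun s => ∫ x, torusVorticitySqAt (u s) x ^ (q / 2)) R (Icc a b) t) :
    R ≤ q * ∫ x, torusVorticitySqAt (u t) x ^ (q / 2 - 1) * torusStretchingDensity (u t) x := by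
  have hq2 : q / 2 = (m : ℝ) := by rw [hq]; ring
  have hq21 : q / 2 - 1 = ((m - 1 : ℕ) : ℝ) := by rw [hq2, Nat.cast_sub hm, Nat.cast_one]
  have hR' : HasDerivWithinAt (fun s => ∫ x, torusVorticitySqAt (u s) x ^ m) R (Icc a b) t := by
    refine hR.congr_of_mem (fun s _ => integral_congr_ae (ae_of_all _ fun x => ?_)) ht
    simp only [hq2, Real.rpow_natCast]
  have hle := h.deriv_integral_torusVorticitySqAt_pow_le hν hab hm ht hR'
  have e1 : (∫ x, torusVorticitySqAt (u t) x ^ (q / 2 - 1) * torusStretchingDensity (u t) x) =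
      ∫ x, torusVorticitySqAt (u t) x ^ (m - 1) * torusStretchingDensity (u t) x :=
    integral_congr_ae (ae_of_all _ fun x => by simp only [hq21, Real.rpow_natCast])
  rw [e1, hq]
  exact hle

end Literature.Analysis.FluidPDE
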